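import Mathlib
import Summits.Ventures.DiscreteObjects.Mahler.EngineSoundness

/-!
# Soundness of the census pruning tests on Graeffe ITERATES (venture `DiscreteObjects`, target L)

Cell `pub-namedobj`, seat `pub-namedobj-mahler-g2`. Framing: lottery ticket; floor = certified bounds/negative
ranges.

The engines apply T1/T2 to the Graeffe iterates `P_m` with `B_m = B^{2^m}`. Here: the first iterate of an
even-degree `anti` polynomial is `rec` (`palindromic_of_isGraeffeIterate_of_anti`; for `rec` see
`GraeffePalindromic.lean`), and the residual-free iterate theorems `rec_even_coeff_test_iterate`,
`rec_even_powerSum_test_iterate`, `anti_coeff_test_iterate`, `anti_powerSum_test_iterate` (even `n`; odd `n` in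
`EngineSoundnessOdd.lean`).
-/

namespace Summit.Ventures.DiscreteObjects.Mahler

open Polynomial

/-! ## Iterates -/

/-- The first Graeffe iterate of an even-degree `anti` polynomial is palindromic (`rec`). -/
theorem palindromic_of_isGraeffeIterate_of_anti (p q : ℤ[X]) (d : ℕ) (hdeg : p.natDegree = 2 * d)
    (hapal : ∀ j ≤ 2 * d, p.coeff j = -p.coeff (2 * d - j)) (hG : IsGraeffeIterate p q) :
    ∀ j ≤ 2 * d, q.coeff j = q.coeff (2 * d - j) := by
  obtain ⟨_, hqdeg, hcomp⟩ := hG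
  rw [hdeg] at hqdeg
  set pQ := p.map (Int.castRingHom ℚ) with hpQ
  set qQ := q.map (Int.castRingHom ℚ) with hqQ
  have hpQdeg : pQ.natDegree = 2 * d := by
    rw [hpQ, natDegree_map_eq_of_injective (Int.castRingHom ℚ).injective_int, hdeg]
  have hqQdeg : qQ.natDegree = 2 * d := by
    rw [hqQ, natDegree_map_eq_of_injective (Int.castRingHom ℚ).injective_int, hqdeg]
  have hpQrev : pQ.reverse = -pQ := by
    apply reverse_eq_neg_of_antipalindromic pQ (2 * d) hpQdeg
    intro j hj; rw [hpQ, coeff_map, coeff_map, hapal j hj]; simp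
  have hpfe : ∀ y : ℚ, y ≠ 0 → pQ.eval y = -(y ^ (2 * d) * pQ.eval y⁻¹) := by
    intro y hy
    rw [eval_eq_reverse_eval_inv pQ hy, hpQrev, hpQdeg, eval_neg]; ring
  have hGe : (∀ y : ℚ, qQ.eval (y ^ 2) = pQ.eval y * pQ.eval (-y)) ∨
      (∀ y : ℚ, qQ.eval (y ^ 2) = -(pQ.eval y * pQ.eval (-y))) := by
    rcases hcomp with h | h
    · left; intro y
      have := congrArg (fun f : ℤ[X] => (f.map (Int.castRingHom ℚ)).eval y) h
      simpa [hpQ, hqQ, map_comp, eval_comp] using this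
    · right; intro y
      have := congrArg (fun f : ℤ[X] => (f.map (Int.castRingHom ℚ)).eval y) h
      simpa [hpQ, hqQ, map_comp, eval_comp] using this
  have hqfe : ∀ y : ℚ, y ≠ 0 → qQ.eval (y ^ 2) = (y ^ 2) ^ (2 * d) * qQ.eval (y ^ 2)⁻¹ := by
    intro y hy
    have e1 := hpfe y hy
    have e2 := hpfe (-y) (neg_ne_zero.mpr hy)
    rw [inv_neg, Even.neg_pow (even_two_mul d)] at e2
    have hsq : (y ^ 2)⁻¹ = y⁻¹ ^ 2 := by rw [inv_pow]
    rcases hGe with h | h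
    · rw [h y, e1, e2, hsq, h y⁻¹]; ring
    · rw [h y, e1, e2, hsq, h y⁻¹]; ring
  have hagree : ∀ y : ℚ, y ≠ 0 → qQ.reverse.eval (y ^ 2) = qQ.eval (y ^ 2) := by
    intro y hy
    have hy2 : (y ^ 2)⁻¹ ≠ 0 := inv_ne_zero (pow_ne_zero 2 hy)
    have h1 := eval_eq_reverse_eval_inv qQ hy2
    rw [inv_inv, hqQdeg] at h1
    have hne : (y ^ 2) ^ (2 * d) ≠ 0 := pow_ne_zero _ (pow_ne_zero 2 hy)
    rw [hqfe y hy, h1, inv_pow, mul_comm (eval (y ^ 2) qQ.reverse), ← mul_assoc, mul_inv_cancel₀ hne,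
      one_mul]
  have hrev : qQ.reverse = qQ := by
    apply Polynomial.eq_of_infinite_eval_eq
    have hsub : Set.range (fun n : ℕ => ((n : ℚ) + 1) ^ 2) ⊆ {x | eval x qQ.reverse = eval x qQ} := by
      rintro _ ⟨n, rfl⟩
      exact hagree _ (by positivity)
    refine Set.Infinite.mono hsub (Set.infinite_range_of_injective ?_)
    intro a b hab
    have h := hab
    simp only at h
    have ha : (0 : ℚ) ≤ (a : ℚ) + 1 := by positivity
    have hb : (0 : ℚ) ≤ (b : ℚ) + 1 := by positivity
    have := (pow_left_inj₀ ha hb two_ne_zero).mp h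
    exact_mod_cast (add_right_cancel this : (a : ℚ) = b)
  have hqQpal := palindromic_of_reverse_eq_self qQ (2 * d) hqQdeg hrev
  intro j hj
  have h := hqQpal j hj
  rw [hqQ, coeff_map, coeff_map] at h
  exact (Int.castRingHom ℚ).injective_int h

/-- **T2 on iterates, rec family (even degree), no residual hypothesis.** -/
theorem rec_even_coeff_test_iterate (P Q : ℤ[X]) (m d : ℕ) (hd : 1 ≤ d) (hG : GraeffeChain P m Q)
    (hmonic : P.Monic) (hdeg : P.natDegree = 2 * d) (hpal : ∀ j ≤ 2 * d, P.coeff j = P.coeff (2 * d - j))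
    {B : ℝ} (hB : intMahlerMeasure P < B) (i : ℕ) (hi1 : 1 ≤ i) (hi2 : i ≤ 2 * d - 1) :
    (|Q.coeff i| : ℝ) < ((X ^ 2 + C (B ^ 2 ^ m + (B ^ 2 ^ m)⁻¹) * X + 1 : ℝ[X]) * (X + 1) ^ (2 * d - 2)).coeff i := by
  obtain ⟨hQdeg, hQpal⟩ := palindromic_of_graeffeChain hG d hdeg hpal
  have hQmonic : Q.Monic := by
    cases hG with
    | refl => exact hmonic
    | step _ hqr => exact hqr.1
  exact rec_even_coeff_test Q d hd hQmonic hQdeg hQpal (graeffe_bound hG hB) i hi1 hi2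

/-- **T1 on iterates, rec family (even degree), no residual hypothesis.** -/
theorem rec_even_powerSum_test_iterate (P Q : ℤ[X]) (m d : ℕ) (hd : 1 ≤ d) (hG : GraeffeChain P m Q)
    (hmonic : P.Monic) (hdeg : P.natDegree = 2 * d) (hpal : ∀ j ≤ 2 * d, P.coeff j = P.coeff (2 * d - j))
    {B : ℝ} (hB : intMahlerMeasure P < B) {k : ℕ} (hk : 0 < k) :
    ‖(((Q.map (Int.castRingHom ℂ)).roots).map fun z => z ^ k).sum‖ <
      (2 * d - 2 : ℝ) + (B ^ 2 ^ m) ^ k + ((B ^ 2 ^ m) ^ k)⁻¹ := by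
  obtain ⟨hQdeg, hQpal⟩ := palindromic_of_graeffeChain hG d hdeg hpal
  have hQmonic : Q.Monic := by
    cases hG with
    | refl => exact hmonic
    | step _ hqr => exact hqr.1
  exact rec_even_powerSum_test Q d hd hQmonic hQdeg hQpal (graeffe_bound hG hB) hk

/-- Iterates (`m ≥ 1`) of an even-degree `anti` polynomial are `rec`: degree and palindromicity along the chain. -/
theorem palindromic_of_graeffeChain_anti {P Q : ℤ[X]} {m : ℕ} (hG : GraeffeChain P (m + 1) Q) (d : ℕ)
    (hdeg : P.natDegree = 2 * d) (hapal : ∀ j ≤ 2 * d, P.coeff j = -P.coeff (2 * d - j)) :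
    Q.natDegree = 2 * d ∧ (∀ j ≤ 2 * d, Q.coeff j = Q.coeff (2 * d - j)) ∧ Q.Monic := by
  induction m generalizing Q with
  | zero =>
    cases hG with
    | step hc hqr =>
      cases hc with
      | refl => exact ⟨hqr.2.1.trans hdeg, palindromic_of_isGraeffeIterate_of_anti _ _ d hdeg hapal hqr, hqr.1⟩
  | succ m ih =>
    cases hG with
    | step hc hqr =>
      obtain ⟨hdeg', hpal', _⟩ := ih hc
      exact ⟨hqr.2.1.trans hdeg', palindromic_of_isGraeffeIterate _ _ d hdeg' hpal' hqr, hqr.1⟩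

/-- **T2 on iterates (`m ≥ 1`), anti family.** -/
theorem anti_coeff_test_iterate (P Q : ℤ[X]) (m d : ℕ) (hd : 1 ≤ d) (hG : GraeffeChain P (m + 1) Q)
    (hdeg : P.natDegree = 2 * d) (hapal : ∀ j ≤ 2 * d, P.coeff j = -P.coeff (2 * d - j))
    {B : ℝ} (hB : intMahlerMeasure P < B) (i : ℕ) (hi1 : 1 ≤ i) (hi2 : i ≤ 2 * d - 1) :
    (|Q.coeff i| : ℝ) <
      ((X ^ 2 + C (B ^ 2 ^ (m + 1) + (B ^ 2 ^ (m + 1))⁻¹) * X + 1 : ℝ[X]) * (X + 1) ^ (2 * d - 2)).coeff i := by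
  obtain ⟨hQdeg, hQpal, hQmonic⟩ := palindromic_of_graeffeChain_anti hG d hdeg hapal
  exact rec_even_coeff_test Q d hd hQmonic hQdeg hQpal (graeffe_bound hG hB) i hi1 hi2

/-- **T1 on iterates (`m ≥ 1`), anti family.** -/
theorem anti_powerSum_test_iterate (P Q : ℤ[X]) (m d : ℕ) (hd : 1 ≤ d) (hG : GraeffeChain P (m + 1) Q)
    (hdeg : P.natDegree = 2 * d) (hapal : ∀ j ≤ 2 * d, P.coeff j = -P.coeff (2 * d - j))
    {B : ℝ} (hB : intMahlerMeasure P < B) {k : ℕ} (hk : 0 < k) :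
    ‖(((Q.map (Int.castRingHom ℂ)).roots).map fun z => z ^ k).sum‖ <
      (2 * d - 2 : ℝ) + (B ^ 2 ^ (m + 1)) ^ k + ((B ^ 2 ^ (m + 1)) ^ k)⁻¹ := by
  obtain ⟨hQdeg, hQpal, hQmonic⟩ := palindromic_of_graeffeChain_anti hG d hdeg hapal
  exact rec_even_powerSum_test Q d hd hQmonic hQdeg hQpal (graeffe_bound hG hB) hk

end Summit.Ventures.DiscreteObjects.Mahler
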